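import Summits.BirchSwinnertonDyer.BirchSwinnertonDyer.Theorems.ErratumRoadFiveRest3DLeverRungs
import Summits.BirchSwinnertonDyer.BirchSwinnertonDyer.Theses.ErratumRoadFive
import HarnessLib

/-!
# Route `ErratumRoadFive` (rung K2, `p ≥ 5`), crux `RamNoErratumDataAtFive` (item stmt-BirchSwinnertonDyer-19624, REST‴):
# THE LEVER LINE BY NAME — the residual branch (D) `Rest3ShaDivisibleBranchAtFive` (and REST‴ itself) from the route's support items
# + the cyclotomic lever's PUBLISHED facts + Schneider's non-degeneracy ON THOSE PAIRS ONLY; and the four kernel-certified rungs of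
# that class-wide input at D1, D2, D4, D6 BY NAME
# (cell `bsd-stepL`, OWNER seat `bsd-stepL-rest-p2` g7; `--supports stmt-BirchSwinnertonDyer-19624`; leaf — imports the route file)

HONEST FRAMING: THEOREMS ONLY (no definition, no named fact, no `sorry`); CONDITIONAL bridges; nothing is booked; BSD is proved for
no class; no census word of record moves (T7). The class-wide binder `hReg` below — `ClassClosure.RegulatorNonvanishingAt W p` at every
pair of the branch — IS Schneider's conjecture restricted to that branch (barrier `Literature.Barriers.BirchSwinnertonDyer.PAdicHeightNondegeneracy`),
OPEN and asserted NOWHERE; crux 19624 is the programme's HEIGHT-FREE road for these pairs and is not advanced class-wide by this file.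
What the file records EXACTLY (seat g7's census line for the residual SD `stub_rest3_shaDiv` of skeleton v6):

* §1 **`rest3ShaDivisibleBranchAtFive_of_items_of_leverFacts_of_regulatorOnD`** — SD ⟸ `PublishedInputsFive` (19066) +
  `JSWAnticyclotomicControlMult` (19626) + the lever-fact bundle (Skinner 2016 Thm. A, Stein–Wuthrich 2013 Thm. 6.1 ×2 ∕ §4.2 ×2,
  Disegni 2020 Thm. 1, parametrisation — verbatim the (T) skeleton's citable stub `stub_t_leverFacts`) + `Reg₅ ≠ 0` AT EVERY PAIR OF (D);
  and **`ramNoErratumDataAtFive_of_items_of_leverFacts_of_regulatorOnRest3`** — the crux itself from the same with `Reg_p ≠ 0` on all of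
  REST‴ (every REST‴ pair is a (ram) pair at `p ≥ 5`, i.e. on `ClassClosure.LeverLocusAt`). So on the lever road the residual of 19624 is
  EXACTLY Schneider-on-(D): per pair a finite `5`-adic computation, class-wide open.
* §2 **`Rest3Rungs.stub_rung_shaDiv_Dᵢ_lever`** (`i = 1, 2, 4, 6`; the REGISTERED plan-only rungs R6–R9 of skeleton v7 BY NAME) — the crux's instance `P2OpenInputOnTreeAt Dᵢ 5` at four of the seven
  members of (D) of record from the two support items + the lever bundle and NOTHING ELSE (regulator = kernel certificate REG5CERT,
  `Theorems/ErratumRoadFiveRest3DLeverCertKernel.lean`; rungs `Theorems/ErratumRoadFiveRest3DLeverRungs.lean`).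
* §3 **`Rest3Rungs.regulatorOnD_Dᵢ_of_items`** — the class-wide input of §1 AT THE PAIR `(Dᵢ, 5)`, from `PublishedInputsFive` (GZK) alone:
  the rungs of the Schneider-on-(D) stub, closed in the kernel.

PARTITION (D-0054): X11b@p≥5 (B9 ∕ N8) × branch (D) of REST‴ — types-the-object-of (names the residual on the lever road) + four pairs
certified; closes: none (T7). References: [Skinner2016PacificMC] Thm. A, Thm. C; [SteinWuthrich2013] Thm. 6.1, §4.2, Conj. 4.1;
[Disegni2020] Thm. 1; [Schneider1982PadicHeightI] §1; [JetchevSkinnerWan2017] Thm. 3.3.1, §7.4.1; [Castella2018] Thm. 2.3, (1.1);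
[Castella2018Erratum] Thm. 1.1 (iii)–(iv); [KolyvaginEulerSystems1990] Thm. A.
-/

-- the Theorems namespace of this sub repeats the summit name by design (D-0017 nested layout)
set_option linter.dupNamespace false

noncomputable section

open scoped Classical

open WeierstrassCurve
  Literature.NumberTheory.EllipticCurves Literature.NumberTheory.EllipticCurves.ModularForms
  Literature.NumberTheory.EllipticCurves.Rank1Residual
  Literature.NumberTheory.EllipticCurves.Rank1Residual.Typed
  Literature.NumberTheory.EllipticCurves.JetchevSkinnerWan2017
  Literature.NumberTheory.EllipticCurves.SteinWuthrich2013
  Literature.NumberTheory.EllipticCurves.Disegni2020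
  Literature.NumberTheory.EllipticCurves.Skinner2016
  Summit.BirchSwinnertonDyer.Rank1Residual Summit.BirchSwinnertonDyer.Rank1Residual.X11b
  Summit.BirchSwinnertonDyer.BirchSwinnertonDyer.Theses.ErratumRoadFive

namespace Summit.BirchSwinnertonDyer.BirchSwinnertonDyer.Theorems

/-! ## §1 Class-wide: branch (D), and REST‴ itself, on the cyclotomic lever — the residual is Schneider on those pairs -/

/-- **Branch (D) of crux 19624 ON THE LEVER**: `Rest3ShaDivisibleBranchAtFive` ⟸ the route's support items `PublishedInputsFive` (`hF`:
Gross–Zagier, Kolyvagin, Skinner 2016 Thm. C, GZK, modularity) and `JSWAnticyclotomicControlMult` (`h331`), the cyclotomic lever's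
PUBLISHED facts (`hL`, verbatim the (T) skeleton's bundle `stub_t_leverFacts`), and `hReg` — the canonical `p`-adic regulator non-zero
(`ClassClosure.RegulatorNonvanishingAt W p`, Schneider AT THE PAIR) at every pair of the branch: `(E,p)` in X11b, `p ≥ 5`, a (ram) prime,
NO erratum datum, `ord_p s > 0` for every rational value `s` of `#Ш(E)_an`. Proof: sharp form of (D) (`rest3ShaDivisibleBranchAtFive_of_sharp`);
at such a pair the lever (`ClassClosure.bsdp_of_leverLocus_of_regulatorNonvanishing`, locus = the (ram) prime at `p ≥ 5`) gives `BSD(E,p)`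
and one-sided tightness with the JSW control identity (`P2.openInputOnTreeAt_of_bsdp_of_ram`, `p2ControlOnTreeAt_of_thm331Mult`) gives the
open input. `hReg` class-wide is Schneider's conjecture on (D) — OPEN, asserted nowhere; per pair it is a finite computation (§3).
CONDITIONAL; nothing booked. [cite: Skinner2016PacificMC, Thm. A and Thm. C (§1)] [cite: SteinWuthrich2013, Thm. 6.1 (p. 20), §4.2, Conj. 4.1]
[cite: Disegni2020, Thm. 1 (§1.2)] [cite: JetchevSkinnerWan2017, Thm. 3.3.1 and §7.4.1] [cite: Castella2018, Thm. 2.3 (p. 5), (1.1) (p. 2)]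
[cite: Schneider1982PadicHeightI, §1] -/
theorem rest3ShaDivisibleBranchAtFive_of_items_of_leverFacts_of_regulatorOnD
    (hF : PublishedInputsFive) (h331 : JSWAnticyclotomicControlMult)
    (hL : Literature.NumberTheory.EllipticCurves.Skinner2016.thmA_charIdeal_multiplicative ∧
      Literature.NumberTheory.EllipticCurves.SteinWuthrich2013.thm61_nonsplitMultiplicative ∧
      Literature.NumberTheory.EllipticCurves.SteinWuthrich2013.thm61_splitMultiplicative ∧
      Literature.NumberTheory.EllipticCurves.SteinWuthrich2013.exists_isMultCanonical ∧
      Literature.NumberTheory.EllipticCurves.SteinWuthrich2013.exists_isSplitMultCanonical ∧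
      Literature.NumberTheory.EllipticCurves.Disegni2020.thm1_padicBSD_rankOne_multiplicative ∧
      Literature.NumberTheory.EllipticCurves.ModularForms.nonempty_modularParametrizationData)
    (hReg : ∀ (W : WeierstrassCurve ℚ) [W.IsElliptic] [W.IsGloballyMinimal] (p : ℕ) [Fact p.Prime],
      ClassX11b W p → 5 ≤ p → Literature.NumberTheory.EllipticCurves.Rank1Residual.Ram W p →
      ¬ ((∃ (q : ℕ) (_ : Fact q.Prime), q ≠ 2 ∧ q ≠ p ∧ Literature.NumberTheory.EllipticCurves.Rank1Residual.Mult W q ∧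
          ¬ W.HasSplitMultiplicativeReductionAtPrime q ∧ ¬ p ∣ padicValInt q W.minimalDiscriminantInt) ∧
        (∀ P : (W.baseChange ℚ_[p]).toAffine.Point, p • P = 0 → P = 0)) →
      (∀ s : ℚ, shaAn W = (s : ℂ) → 0 < padicValRat p s) →
      ClassClosure.RegulatorNonvanishingAt W p) :
    Rest3ShaDivisibleBranchAtFive := by
  obtain ⟨hGZ, hKo, -, hSk, -, hGZK, hmod, -, -, -, -, -, -, -, -⟩ := hF
  obtain ⟨hSkA, hJn, hJs, hHn, hHs, hD, hpar⟩ := hL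
  refine rest3ShaDivisibleBranchAtFive_of_sharp fun W _ _ p _ hX hp5 _ hram hno hpos ↦ ?_
  exact P2.openInputOnTreeAt_of_bsdp_of_ram W p hGZ hKo hSk hGZK hmod (p2ControlOnTreeAt_of_thm331Mult W p h331 hKo) hram
    (ClassClosure.bsdp_of_leverLocus_of_regulatorNonvanishing W p hSkA hJn hJs hHn hHs hD hGZK hpar hX
      (ClassClosure.leverLocusAt_of_ram_of_five_le W p hram hp5) (hReg W p hX hp5 hram hno hpos))

/-- **The crux REST‴ itself ON THE LEVER** (`RamNoErratumDataAtFive`, item 19624, text by name): from `PublishedInputsFive`,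
`JSWAnticyclotomicControlMult`, the lever bundle and `Reg_p ≠ 0` at every REST‴ pair with `(E,p)` in X11b, `p ≥ 5` (every such pair is a
(ram) pair, hence on the lever locus; both reduction signs at `p`). The class-wide binder is Schneider's conjecture on REST‴ — OPEN; this is
the `p ≥ 5` twin of the (T) skeleton's alternative composition `Rest3TorsionBranchAtFive_of_regulator` (rest-p2 g0) on the whole crux. Crux 19624
is the HEIGHT-FREE road and is not advanced by this display. CONDITIONAL; nothing booked. [cite: Skinner2016PacificMC, Thm. A and Thm. C (§1)]
[cite: SteinWuthrich2013, Thm. 6.1 (p. 20), §4.2, Conj. 4.1] [cite: Disegni2020, Thm. 1 (§1.2)] [cite: Castella2018Erratum, Thm. 1.1 (iii)–(iv)] -/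
theorem ramNoErratumDataAtFive_of_items_of_leverFacts_of_regulatorOnRest3
    (hF : PublishedInputsFive) (h331 : JSWAnticyclotomicControlMult)
    (hL : Literature.NumberTheory.EllipticCurves.Skinner2016.thmA_charIdeal_multiplicative ∧
      Literature.NumberTheory.EllipticCurves.SteinWuthrich2013.thm61_nonsplitMultiplicative ∧
      Literature.NumberTheory.EllipticCurves.SteinWuthrich2013.thm61_splitMultiplicative ∧
      Literature.NumberTheory.EllipticCurves.SteinWuthrich2013.exists_isMultCanonical ∧
      Literature.NumberTheory.EllipticCurves.SteinWuthrich2013.exists_isSplitMultCanonical ∧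
      Literature.NumberTheory.EllipticCurves.Disegni2020.thm1_padicBSD_rankOne_multiplicative ∧
      Literature.NumberTheory.EllipticCurves.ModularForms.nonempty_modularParametrizationData)
    (hReg : ∀ (W : WeierstrassCurve ℚ) [W.IsElliptic] [W.IsGloballyMinimal] (p : ℕ) [Fact p.Prime],
      ClassX11b W p → 5 ≤ p → Literature.NumberTheory.EllipticCurves.Rank1Residual.Ram W p →
      ¬ ((∃ (q : ℕ) (_ : Fact q.Prime), q ≠ 2 ∧ q ≠ p ∧ Literature.NumberTheory.EllipticCurves.Rank1Residual.Mult W q ∧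
          ¬ W.HasSplitMultiplicativeReductionAtPrime q ∧ ¬ p ∣ padicValInt q W.minimalDiscriminantInt) ∧
        (∀ P : (W.baseChange ℚ_[p]).toAffine.Point, p • P = 0 → P = 0)) →
      ClassClosure.RegulatorNonvanishingAt W p) :
    RamNoErratumDataAtFive := by
  obtain ⟨hGZ, hKo, -, hSk, -, hGZK, hmod, -, -, -, -, -, -, -, -⟩ := hF
  obtain ⟨hSkA, hJn, hJs, hHn, hHs, hD, hpar⟩ := hL
  intro W _ _ p _ hram hno
  refine p2OpenInputOnTreeAt_of_imp_surj W p fun hX hp5 _ ↦ ?_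
  exact P2.openInputOnTreeAt_of_bsdp_of_ram W p hGZ hKo hSk hGZK hmod (p2ControlOnTreeAt_of_thm331Mult W p h331 hKo) hram
    (ClassClosure.bsdp_of_leverLocus_of_regulatorNonvanishing W p hSkA hJn hJs hHn hHs hD hGZK hpar hX
      (ClassClosure.leverLocusAt_of_ram_of_five_le W p hram hp5) (hReg W p hX hp5 hram hno))

/-! ## §2 The four kernel-certified rungs BY THE ROUTE'S NAMES -/

namespace Rest3Rungs

/-- **REGISTERED RUNG `stub_rung_shaDiv_D1_lever` (skeleton v7, R-lever) BY NAME — LEVER-ROAD RUNG at `(D1, 5)`** (D1 = 235a1 ⊗ (−2167), a member of branch (D)): `PublishedInputsFive` (19066) +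
`JSWAnticyclotomicControlMult` (19626) + the lever-fact bundle ⟹ `P2OpenInputOnTreeAt D1 5` — NO certificate or data binder (the regulator
input is the kernel theorem `RegMult.LeverD.regulatorNonvanishingAt_D1_baseChange_of_GZK`). CONDITIONAL on the published items; ONE curve;
nothing booked. [cite: Skinner2016PacificMC, Thm. A (§1)] [cite: SteinWuthrich2013, Thm. 6.1, §4.2] [cite: Disegni2020, Thm. 1 (§1.2)]
[cite: JetchevSkinnerWan2017, Thm. 3.3.1] -/
theorem stub_rung_shaDiv_D1_lever
    [((⟨1, 0, 0, -23577276, -23098167619⟩ : WeierstrassCurve ℤ).baseChange ℚ).IsElliptic]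
    [((⟨1, 0, 0, -23577276, -23098167619⟩ : WeierstrassCurve ℤ).baseChange ℚ).IsGloballyMinimal]
    (hF : Summit.BirchSwinnertonDyer.BirchSwinnertonDyer.Theses.ErratumRoadFive.PublishedInputsFive)
    (h331 : Summit.BirchSwinnertonDyer.BirchSwinnertonDyer.Theses.ErratumRoadFive.JSWAnticyclotomicControlMult)
    (hL : Literature.NumberTheory.EllipticCurves.Skinner2016.thmA_charIdeal_multiplicative ∧
      Literature.NumberTheory.EllipticCurves.SteinWuthrich2013.thm61_nonsplitMultiplicative ∧
      Literature.NumberTheory.EllipticCurves.SteinWuthrich2013.thm61_splitMultiplicative ∧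
      Literature.NumberTheory.EllipticCurves.SteinWuthrich2013.exists_isMultCanonical ∧
      Literature.NumberTheory.EllipticCurves.SteinWuthrich2013.exists_isSplitMultCanonical ∧
      Literature.NumberTheory.EllipticCurves.Disegni2020.thm1_padicBSD_rankOne_multiplicative ∧
      Literature.NumberTheory.EllipticCurves.ModularForms.nonempty_modularParametrizationData) :
    Summit.BirchSwinnertonDyer.Rank1Residual.X11b.P2OpenInputOnTreeAt
      ((⟨1, 0, 0, -23577276, -23098167619⟩ : WeierstrassCurve ℤ).baseChange ℚ) 5 := by
  obtain ⟨hGZ, hKo, -, hSk, -, hGZK, hmod, -, -, -, -, -, -, -, -⟩ := hF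
  obtain ⟨hSkA, hJn, hJs, hHn, hHs, hD, hpar⟩ := hL
  exact rung_D1_lever hGZ hKo hSk hGZK hmod h331 hSkA hJn hJs hHn hHs hD hpar

/-- **REGISTERED RUNG `stub_rung_shaDiv_D2_lever` (skeleton v7, R-lever) BY NAME — LEVER-ROAD RUNG at `(D2, 5)`** (D2 = 635b1 ⊗ (−2872), a member of branch (D)): `PublishedInputsFive` (19066) +
`JSWAnticyclotomicControlMult` (19626) + the lever-fact bundle ⟹ `P2OpenInputOnTreeAt D2 5` — NO certificate or data binder (the regulator
input is the kernel theorem `RegMult.LeverD.regulatorNonvanishingAt_D2_baseChange_of_GZK`). CONDITIONAL on the published items; ONE curve;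
nothing booked. [cite: Skinner2016PacificMC, Thm. A (§1)] [cite: SteinWuthrich2013, Thm. 6.1, §4.2] [cite: Disegni2020, Thm. 1 (§1.2)]
[cite: JetchevSkinnerWan2017, Thm. 3.3.1] -/
theorem stub_rung_shaDiv_D2_lever
    [((⟨0, 1, 0, -5327081, -4755412951⟩ : WeierstrassCurve ℤ).baseChange ℚ).IsElliptic]
    [((⟨0, 1, 0, -5327081, -4755412951⟩ : WeierstrassCurve ℤ).baseChange ℚ).IsGloballyMinimal]
    (hF : Summit.BirchSwinnertonDyer.BirchSwinnertonDyer.Theses.ErratumRoadFive.PublishedInputsFive)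
    (h331 : Summit.BirchSwinnertonDyer.BirchSwinnertonDyer.Theses.ErratumRoadFive.JSWAnticyclotomicControlMult)
    (hL : Literature.NumberTheory.EllipticCurves.Skinner2016.thmA_charIdeal_multiplicative ∧
      Literature.NumberTheory.EllipticCurves.SteinWuthrich2013.thm61_nonsplitMultiplicative ∧
      Literature.NumberTheory.EllipticCurves.SteinWuthrich2013.thm61_splitMultiplicative ∧
      Literature.NumberTheory.EllipticCurves.SteinWuthrich2013.exists_isMultCanonical ∧
      Literature.NumberTheory.EllipticCurves.SteinWuthrich2013.exists_isSplitMultCanonical ∧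
      Literature.NumberTheory.EllipticCurves.Disegni2020.thm1_padicBSD_rankOne_multiplicative ∧
      Literature.NumberTheory.EllipticCurves.ModularForms.nonempty_modularParametrizationData) :
    Summit.BirchSwinnertonDyer.Rank1Residual.X11b.P2OpenInputOnTreeAt
      ((⟨0, 1, 0, -5327081, -4755412951⟩ : WeierstrassCurve ℤ).baseChange ℚ) 5 := by
  obtain ⟨hGZ, hKo, -, hSk, -, hGZK, hmod, -, -, -, -, -, -, -, -⟩ := hF
  obtain ⟨hSkA, hJn, hJs, hHn, hHs, hD, hpar⟩ := hL
  exact rung_D2_lever hGZ hKo hSk hGZK hmod h331 hSkA hJn hJs hHn hHs hD hpar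

/-- **REGISTERED RUNG `stub_rung_shaDiv_D4_lever` (skeleton v7, R-lever) BY NAME — LEVER-ROAD RUNG at `(D4, 5)`** (D4 = 995b1 ⊗ (−2363), a member of branch (D)): `PublishedInputsFive` (19066) +
`JSWAnticyclotomicControlMult` (19626) + the lever-fact bundle ⟹ `P2OpenInputOnTreeAt D4 5` — NO certificate or data binder (the regulator
input is the kernel theorem `RegMult.LeverD.regulatorNonvanishingAt_D4_baseChange_of_GZK`). CONDITIONAL on the published items; ONE curve;
nothing booked. [cite: Skinner2016PacificMC, Thm. A (§1)] [cite: SteinWuthrich2013, Thm. 6.1, §4.2] [cite: Disegni2020, Thm. 1 (§1.2)]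
[cite: JetchevSkinnerWan2017, Thm. 3.3.1] -/
theorem stub_rung_shaDiv_D4_lever
    [((⟨0, 1, 1, -85617791, -320971224710⟩ : WeierstrassCurve ℤ).baseChange ℚ).IsElliptic]
    [((⟨0, 1, 1, -85617791, -320971224710⟩ : WeierstrassCurve ℤ).baseChange ℚ).IsGloballyMinimal]
    (hF : Summit.BirchSwinnertonDyer.BirchSwinnertonDyer.Theses.ErratumRoadFive.PublishedInputsFive)
    (h331 : Summit.BirchSwinnertonDyer.BirchSwinnertonDyer.Theses.ErratumRoadFive.JSWAnticyclotomicControlMult)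
    (hL : Literature.NumberTheory.EllipticCurves.Skinner2016.thmA_charIdeal_multiplicative ∧
      Literature.NumberTheory.EllipticCurves.SteinWuthrich2013.thm61_nonsplitMultiplicative ∧
      Literature.NumberTheory.EllipticCurves.SteinWuthrich2013.thm61_splitMultiplicative ∧
      Literature.NumberTheory.EllipticCurves.SteinWuthrich2013.exists_isMultCanonical ∧
      Literature.NumberTheory.EllipticCurves.SteinWuthrich2013.exists_isSplitMultCanonical ∧
      Literature.NumberTheory.EllipticCurves.Disegni2020.thm1_padicBSD_rankOne_multiplicative ∧
      Literature.NumberTheory.EllipticCurves.ModularForms.nonempty_modularParametrizationData) :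
    Summit.BirchSwinnertonDyer.Rank1Residual.X11b.P2OpenInputOnTreeAt
      ((⟨0, 1, 1, -85617791, -320971224710⟩ : WeierstrassCurve ℤ).baseChange ℚ) 5 := by
  obtain ⟨hGZ, hKo, -, hSk, -, hGZK, hmod, -, -, -, -, -, -, -, -⟩ := hF
  obtain ⟨hSkA, hJn, hJs, hHn, hHs, hD, hpar⟩ := hL
  exact rung_D4_lever hGZ hKo hSk hGZK hmod h331 hSkA hJn hJs hHn hHs hD hpar

/-- **REGISTERED RUNG `stub_rung_shaDiv_D6_lever` (skeleton v7, R-lever) BY NAME — LEVER-ROAD RUNG at `(D6, 5)`** (D6 = 985b1 ⊗ (−3963), a member of branch (D)): `PublishedInputsFive` (19066) +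
`JSWAnticyclotomicControlMult` (19626) + the lever-fact bundle ⟹ `P2OpenInputOnTreeAt D6 5` — NO certificate or data binder (the regulator
input is the kernel theorem `RegMult.LeverD.regulatorNonvanishingAt_D6_baseChange_of_GZK`). CONDITIONAL on the published items; ONE curve;
nothing booked. [cite: Skinner2016PacificMC, Thm. A (§1)] [cite: SteinWuthrich2013, Thm. 6.1, §4.2] [cite: Disegni2020, Thm. 1 (§1.2)]
[cite: JetchevSkinnerWan2017, Thm. 3.3.1] -/
theorem stub_rung_shaDiv_D6_lever
    [((⟨0, 0, 1, -319342503, -1928875397967⟩ : WeierstrassCurve ℤ).baseChange ℚ).IsElliptic]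
    [((⟨0, 0, 1, -319342503, -1928875397967⟩ : WeierstrassCurve ℤ).baseChange ℚ).IsGloballyMinimal]
    (hF : Summit.BirchSwinnertonDyer.BirchSwinnertonDyer.Theses.ErratumRoadFive.PublishedInputsFive)
    (h331 : Summit.BirchSwinnertonDyer.BirchSwinnertonDyer.Theses.ErratumRoadFive.JSWAnticyclotomicControlMult)
    (hL : Literature.NumberTheory.EllipticCurves.Skinner2016.thmA_charIdeal_multiplicative ∧
      Literature.NumberTheory.EllipticCurves.SteinWuthrich2013.thm61_nonsplitMultiplicative ∧
      Literature.NumberTheory.EllipticCurves.SteinWuthrich2013.thm61_splitMultiplicative ∧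
      Literature.NumberTheory.EllipticCurves.SteinWuthrich2013.exists_isMultCanonical ∧
      Literature.NumberTheory.EllipticCurves.SteinWuthrich2013.exists_isSplitMultCanonical ∧
      Literature.NumberTheory.EllipticCurves.Disegni2020.thm1_padicBSD_rankOne_multiplicative ∧
      Literature.NumberTheory.EllipticCurves.ModularForms.nonempty_modularParametrizationData) :
    Summit.BirchSwinnertonDyer.Rank1Residual.X11b.P2OpenInputOnTreeAt
      ((⟨0, 0, 1, -319342503, -1928875397967⟩ : WeierstrassCurve ℤ).baseChange ℚ) 5 := by
  obtain ⟨hGZ, hKo, -, hSk, -, hGZK, hmod, -, -, -, -, -, -, -, -⟩ := hF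
  obtain ⟨hSkA, hJn, hJs, hHn, hHs, hD, hpar⟩ := hL
  exact rung_D6_lever hGZ hKo hSk hGZK hmod h331 hSkA hJn hJs hHn hHs hD hpar

/-! ## §3 The class-wide input of §1 AT THE FOUR PAIRS, from `PublishedInputsFive` alone (the Schneider-on-(D) rungs) -/

/-- **Schneider AT THE PAIR `(D1, 5)` from the support item `PublishedInputsFive` alone** (its GZK conjunct; the computation is
the kernel certificate `RegMult.LeverD.regulatorNonvanishingAt_D1_baseChange_of_GZK`): the §1 binder `hReg` instantiated at D1 — given
`ClassX11b D1 5`, `ClassClosure.RegulatorNonvanishingAt D1 5`. ONE curve; nothing class-wide. [cite: SteinWuthrich2013, §4.2 and Conj. 4.1]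
[cite: KolyvaginEulerSystems1990, Thm. A] -/
theorem regulatorOnD_D1_of_items
    [((⟨1, 0, 0, -23577276, -23098167619⟩ : WeierstrassCurve ℤ).baseChange ℚ).IsElliptic] [((⟨1, 0, 0, -23577276, -23098167619⟩ : WeierstrassCurve ℤ).baseChange ℚ).IsGloballyMinimal]
    (hF : PublishedInputsFive) (hX : ClassX11b ((⟨1, 0, 0, -23577276, -23098167619⟩ : WeierstrassCurve ℤ).baseChange ℚ) 5) :
    ClassClosure.RegulatorNonvanishingAt ((⟨1, 0, 0, -23577276, -23098167619⟩ : WeierstrassCurve ℤ).baseChange ℚ) 5 := by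
  obtain ⟨-, -, -, -, -, hGZK, -, -, -, -, -, -, -, -, -⟩ := hF
  exact RegMult.LeverD.regulatorNonvanishingAt_D1_baseChange_of_GZK hGZK hX

/-- **Schneider AT THE PAIR `(D2, 5)` from the support item `PublishedInputsFive` alone** (its GZK conjunct; the computation is
the kernel certificate `RegMult.LeverD.regulatorNonvanishingAt_D2_baseChange_of_GZK`): the §1 binder `hReg` instantiated at D2 — given
`ClassX11b D2 5`, `ClassClosure.RegulatorNonvanishingAt D2 5`. ONE curve; nothing class-wide. [cite: SteinWuthrich2013, §4.2 and Conj. 4.1]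
[cite: KolyvaginEulerSystems1990, Thm. A] -/
theorem regulatorOnD_D2_of_items
    [((⟨0, 1, 0, -5327081, -4755412951⟩ : WeierstrassCurve ℤ).baseChange ℚ).IsElliptic] [((⟨0, 1, 0, -5327081, -4755412951⟩ : WeierstrassCurve ℤ).baseChange ℚ).IsGloballyMinimal]
    (hF : PublishedInputsFive) (hX : ClassX11b ((⟨0, 1, 0, -5327081, -4755412951⟩ : WeierstrassCurve ℤ).baseChange ℚ) 5) :
    ClassClosure.RegulatorNonvanishingAt ((⟨0, 1, 0, -5327081, -4755412951⟩ : WeierstrassCurve ℤ).baseChange ℚ) 5 := by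
  obtain ⟨-, -, -, -, -, hGZK, -, -, -, -, -, -, -, -, -⟩ := hF
  exact RegMult.LeverD.regulatorNonvanishingAt_D2_baseChange_of_GZK hGZK hX

/-- **Schneider AT THE PAIR `(D4, 5)` from the support item `PublishedInputsFive` alone** (its GZK conjunct; the computation is
the kernel certificate `RegMult.LeverD.regulatorNonvanishingAt_D4_baseChange_of_GZK`): the §1 binder `hReg` instantiated at D4 — given
`ClassX11b D4 5`, `ClassClosure.RegulatorNonvanishingAt D4 5`. ONE curve; nothing class-wide. [cite: SteinWuthrich2013, §4.2 and Conj. 4.1]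
[cite: KolyvaginEulerSystems1990, Thm. A] -/
theorem regulatorOnD_D4_of_items
    [((⟨0, 1, 1, -85617791, -320971224710⟩ : WeierstrassCurve ℤ).baseChange ℚ).IsElliptic] [((⟨0, 1, 1, -85617791, -320971224710⟩ : WeierstrassCurve ℤ).baseChange ℚ).IsGloballyMinimal]
    (hF : PublishedInputsFive) (hX : ClassX11b ((⟨0, 1, 1, -85617791, -320971224710⟩ : WeierstrassCurve ℤ).baseChange ℚ) 5) :
    ClassClosure.RegulatorNonvanishingAt ((⟨0, 1, 1, -85617791, -320971224710⟩ : WeierstrassCurve ℤ).baseChange ℚ) 5 := by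
  obtain ⟨-, -, -, -, -, hGZK, -, -, -, -, -, -, -, -, -⟩ := hF
  exact RegMult.LeverD.regulatorNonvanishingAt_D4_baseChange_of_GZK hGZK hX

/-- **Schneider AT THE PAIR `(D6, 5)` from the support item `PublishedInputsFive` alone** (its GZK conjunct; the computation is
the kernel certificate `RegMult.LeverD.regulatorNonvanishingAt_D6_baseChange_of_GZK`): the §1 binder `hReg` instantiated at D6 — given
`ClassX11b D6 5`, `ClassClosure.RegulatorNonvanishingAt D6 5`. ONE curve; nothing class-wide. [cite: SteinWuthrich2013, §4.2 and Conj. 4.1]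
[cite: KolyvaginEulerSystems1990, Thm. A] -/
theorem regulatorOnD_D6_of_items
    [((⟨0, 0, 1, -319342503, -1928875397967⟩ : WeierstrassCurve ℤ).baseChange ℚ).IsElliptic] [((⟨0, 0, 1, -319342503, -1928875397967⟩ : WeierstrassCurve ℤ).baseChange ℚ).IsGloballyMinimal]
    (hF : PublishedInputsFive) (hX : ClassX11b ((⟨0, 0, 1, -319342503, -1928875397967⟩ : WeierstrassCurve ℤ).baseChange ℚ) 5) :
    ClassClosure.RegulatorNonvanishingAt ((⟨0, 0, 1, -319342503, -1928875397967⟩ : WeierstrassCurve ℤ).baseChange ℚ) 5 := by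
  obtain ⟨-, -, -, -, -, hGZK, -, -, -, -, -, -, -, -, -⟩ := hF
  exact RegMult.LeverD.regulatorNonvanishingAt_D6_baseChange_of_GZK hGZK hX

end Rest3Rungs

end Summit.BirchSwinnertonDyer.BirchSwinnertonDyer.Theorems

end
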